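import Literature.NumberTheory.IwasawaTheory.Fukuda1994Thm1RankLayer
import Literature.NumberTheory.NumberFields.UnramifiedElementaryCentralModP
import Literature.NumberTheory.NumberFields.PureCubicClassNumberModThreeProofs
import HarnessLib

/-!
# Fukuda's package with a CENTRAL layer — the per-layer class-field-theoretic input: if `Gal(K_{n+j}/K)` acts trivially on
# `Cl(K_{n+j})/p`, then `⁅Gal(H_p/K_n), Gal(H_p/K_{n+j})⁆ ≤ N_j·P_j` (door L11 step (iii-b) of the cell `bsd-potss`; proved)

Topic `NumberTheory/IwasawaTheory` (namespace = path). THEOREM-ONLY file (no definition, no named fact, no `sorry`), written by the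
literature seat `bsd-potss-conjA-anchor` g21 (cell `bsd-potss`; serves the asides stmt-BirchSwinnertonDyer-19386 / 19413; closes nothing).
Companion of `Fukuda1994Thm1RankLayer.exists_layer` (k8t-c4 g20) with the SAME interface (the caller — the package
`Fukuda1994Thm1RankPackage(Central)` — has built the top layer `T = K_{n+t}`, the base `B = K_n ⊆ T` as `Bi`, the `p`-Hilbert class field
`H_p = HqF` of `T` over `T`, Galois over `Bi`, of degree `p^t·p^v` over `Bi`, the subgroup `A' = Gal(H_p/T)` and the inertia family `𝓘`).
OUTPUT (`exists_layer_central`): the layer `G_j = Gal(H_p/K_{n+j}) ≤ G = Gal(H_p/K_n)` (image of restriction of scalars; `A' ≤ G_j`,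
`[G : G_j] = p^j` — by `FukudaGroup.layer_eq_sup_zpowers` this pins `G_j` down as the `G_j` of `exists_layer`) satisfies
**`⁅G, G_j⁆ ≤ N_j·P_j`** (`N_j = G_j'·⟨I ∩ G_j : I ∈ 𝓘⟩`, `P_j = ⟨x^p : x ∈ G_j⟩`) PROVIDED every `K`-automorphism `σ` of `K_{n+j}` acts
trivially on `Cl(K_{n+j})/Cl(K_{n+j})^p` (`σc·c⁻¹ ∈ Cl^p`; for the census `n = 0`, `j = 1`: «`Gal(K₁/K)` acts trivially on `Cl(K₁)/p`»).
This is the hypothesis `hcent` of `FukudaGroup.relIndex_layer_le_of_commutator_le` (conjA-anchor g20, `FukudaGroupCentralLayer`):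
the nilpotency-index form (`m = 1`) of the one-layer `μ = 0` criterion.

PROOF.  `NumberFields.commutator_top_range_le_map_of_classGroup_mulEquiv` (conjA-anchor g21, `UnramifiedElementaryCentralModP`: class
field theory + equivariance of the Artin symbol) with `k = Bi`, `M = F_j` (the copy of `K_{n+j}` inside `T` over `Bi`), `E = HqF`; the
class-group hypothesis is transported from `K_{n+j}` to `F_j` along the `K`-isomorphism `K_{n+j} ≃ F_j` (functoriality of
`ClassGroup.mulEquiv`, tree `Honda1971.classGroup_mulEquiv_trans`); the images of `N_j`, `P_j` under `Gal(H_p/F_j) ↪ Gal(H_p/Bi)` are rewritten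
exactly as in `exists_layer`.

References: [Washington1997] §13.3 Lemmas 13.15, 13.18, Prop. 13.22 (the `Γ`-module `X/(ν_n Y + pX) ≅ A_n/p`); [Fukuda1994] Thm. 1 (2),
p. 264 (proof); [NeukirchANT1999] Ch. IV §6, Ch. VI §7 Thm. (7.1); [Cox2013] §8.A Thm. 8.10.
-/

noncomputable section

open scoped NumberField IsMulCommutative
open NumberField IsDedekindDomain Field IntermediateField

namespace Literature.NumberTheory.IwasawaTheory

open Literature.NumberTheory.EllipticCurves Literature.NumberTheory.GaloisRepresentations
  Literature.NumberTheory.NumberFields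

variable {K : Type} [Field K] [NumberField K] {p : ℕ} [hp : Fact p.Prime]

set_option maxHeartbeats 40000000 in
set_option synthInstance.maxHeartbeats 400000 in
/-- **The layer `G_j = Gal(H_p/K_{n+j})` is CENTRAL modulo `N_j·P_j` when `Gal(K_{n+j}/K)` acts trivially on `Cl(K_{n+j})/p`**
(interface of `Fukuda1994Thm1RankLayer.exists_layer`; `v` is `ord_p h(K_{n+t})`, only `[H_p : K_n] = p^t·p^v` is used): there is
`G_j ≤ Gal(H_p/K_n)` with `A' ≤ G_j`, `[G : G_j] = p^j` and `⁅G, G_j⁆ ≤ (G_j'·⟨I ∩ G_j⟩)·⟨x^p : x ∈ G_j⟩`.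
[cite: Washington1997, §13.3 Lemmas 13.15 and 13.18, Prop. 13.22] [cite: Fukuda1994, Thm. 1 (2), p. 264 (proof)]
[cite: NeukirchANT1999, Ch. IV §6 and Ch. VI §7 Thm. (7.1)] -/
theorem exists_layer_central (κ : ZpExtension K p) (n t j : ℕ) (hj : j ≤ t)
    [FiniteDimensional K (κ.layer (n + t))] [IsGalois K (κ.layer (n + t))] [NumberField (κ.layer (n + t))]
    (Bi : IntermediateField K (κ.layer (n + t))) (hBi : Bi = IntermediateField.restrict (κ.layer_mono (Nat.le_add_right n t)))
    [FiniteDimensional K Bi] [IsGalois K Bi] [NumberField Bi] [IsGalois Bi (κ.layer (n + t))]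
    (hdegKB : Module.finrank K Bi = p ^ n)
    [IsGalois Bi (hilbertClassField (κ.layer (n + t)))] [FiniteDimensional Bi (hilbertClassField (κ.layer (n + t)))]
    (HqF : IntermediateField (κ.layer (n + t)) (hilbertClassField (κ.layer (n + t))))
    [IsGalois Bi HqF] [FiniteDimensional Bi HqF] [NumberField HqF] [IsScalarTower Bi HqF (hilbertClassField (κ.layer (n + t)))]
    [IsGalois (κ.layer (n + t)) HqF] [IsUnramifiedAtInfinitePlaces Bi HqF] [IsScalarTower Bi (κ.layer (n + t)) HqF]
    (v : ℕ) (hdegHp : Module.finrank Bi HqF = p ^ t * p ^ v)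
    (A' : Subgroup (HqF ≃ₐ[Bi] HqF))
    (hmemA' : ∀ g : HqF ≃ₐ[Bi] HqF, g ∈ A' ↔ ∀ x : (κ.layer (n + t)), g (algebraMap (κ.layer (n + t)) HqF x) = algebraMap (κ.layer (n + t)) HqF x)
    (𝓘 : Set (Subgroup (HqF ≃ₐ[Bi] HqF)))
    (h𝓘def : 𝓘 = Set.range (fun Q : MaximalSpectrum (𝓞 HqF) => Q.asIdeal.inertia (HqF ≃ₐ[Bi] HqF)))
    (hσ : ∀ (σ : (κ.layer (n + j)) ≃ₐ[K] (κ.layer (n + j))) (c : ClassGroup (𝓞 (κ.layer (n + j)))),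
      ClassGroup.mulEquiv (AmbiguousClass.intAut σ) c * c⁻¹ ∈
        (powMonoidHom p : ClassGroup (𝓞 (κ.layer (n + j))) →* ClassGroup (𝓞 (κ.layer (n + j)))).range) :
    ∃ Gj : Subgroup (HqF ≃ₐ[Bi] HqF), A' ≤ Gj ∧ Gj.index = p ^ j ∧
      ⁅(⊤ : Subgroup (HqF ≃ₐ[Bi] HqF)), Gj⁆ ≤
        (⁅Gj, Gj⁆ ⊔ ⨆ I ∈ 𝓘, I ⊓ Gj) ⊔ Subgroup.closure ((fun x : HqF ≃ₐ[Bi] HqF => x ^ p) '' (Gj : Set (HqF ≃ₐ[Bi] HqF))) := by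
  classical
  have hp0 : 0 < p := hp.out.pos
  haveI : FiniteDimensional K (κ.layer (n + j)) := κ.finiteDimensional_layer_holds (n + j)
  haveI : IsGalois K (κ.layer (n + j)) := κ.isGalois_layer_holds (n + j)
  haveI : NumberField (κ.layer (n + j)) := NumberField.of_module_finite K _
  have hBFj : κ.layer n ≤ κ.layer (n + j) := κ.layer_mono (Nat.le_add_right n j)
  have hFjF : κ.layer (n + j) ≤ κ.layer (n + t) := κ.layer_mono (by omega)
  obtain ⟨Fji, hFji⟩ : ∃ Fji : IntermediateField K (κ.layer (n + t)), Fji = IntermediateField.restrict hFjF := ⟨_, rfl⟩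
  have hBiFji : Bi ≤ Fji := by
    intro x hx
    rw [hBi, IntermediateField.mem_restrict] at hx
    rw [hFji, IntermediateField.mem_restrict]
    exact hBFj hx
  let eFj : (κ.layer (n + j)) ≃ₐ[K] Fji :=
    (IntermediateField.restrict_algEquiv hFjF).trans (IntermediateField.equivOfEq hFji.symm)
  obtain ⟨Fje, hFje⟩ : ∃ Fje : IntermediateField Bi (κ.layer (n + t)), Fje = IntermediateField.extendScalars hBiFji :=
    ⟨_, rfl⟩
  have hmemFje : ∀ x : (κ.layer (n + t)), x ∈ Fje ↔ x ∈ Fji := fun x => by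
    rw [hFje, IntermediateField.mem_extendScalars]
  let eFje : Fji ≃+* Fje :=
    { toFun := fun x => ⟨x, (hmemFje _).mpr x.2⟩
      invFun := fun x => ⟨x, (hmemFje _).mp x.2⟩
      left_inv := fun _ => rfl
      right_inv := fun _ => rfl
      map_mul' := fun _ _ => rfl
      map_add' := fun _ _ => rfl }
  haveI : FiniteDimensional K Fji := LinearEquiv.finiteDimensional eFj.toLinearEquiv
  haveI : IsGalois K Fji := IsGalois.of_algEquiv eFj
  haveI : NumberField Fji := NumberField.of_module_finite K _
  haveI hFjefd : FiniteDimensional K Fje := by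
    have : FiniteDimensional K (Fje.restrictScalars K) := by rw [hFje, IntermediateField.extendScalars_restrictScalars]; infer_instance
    exact this
  haveI : IsGalois K Fje := by
    have : IsGalois K (Fje.restrictScalars K) := by rw [hFje, IntermediateField.extendScalars_restrictScalars]; infer_instance
    exact this
  haveI : NumberField Fje := NumberField.of_module_finite K _
  haveI : IsGalois Bi Fje := IsGalois.tower_top_of_isGalois K Bi Fje
  haveI : IsScalarTower K Fje (κ.layer (n + t)) := IsScalarTower.of_algebraMap_eq fun _ => rfl
  haveI : IsGalois Fje (κ.layer (n + t)) := IsGalois.tower_top_of_isGalois K Fje (κ.layer (n + t))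
  -- scalar towers for `HqF` over `F_j`
  haveI : IsScalarTower Bi Fje HqF := IsScalarTower.of_algebraMap_eq fun _ => rfl
  haveI : IsScalarTower K Fje HqF := IsScalarTower.of_algebraMap_eq fun _ => rfl
  haveI : IsGalois Fje HqF := IsGalois.tower_top_of_isGalois Bi Fje HqF
  haveI : FiniteDimensional Fje HqF := Module.Finite.of_restrictScalars_finite Bi Fje HqF
  haveI : IsUnramifiedAtInfinitePlaces Fje HqF := IsUnramifiedAtInfinitePlaces.top (k := Bi) (K := Fje) (F := HqF)
  haveI : Module.Free Fje HqF := Module.Free.of_divisionRing Fje HqF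
  haveI : Module.Free Bi Fje := Module.Free.of_divisionRing Bi Fje
  haveI : Module.Free Bi HqF := Module.Free.of_divisionRing Bi HqF
  -- degrees
  have hdegBFj : Module.finrank Bi Fje = p ^ j := by
    have h := Module.finrank_mul_finrank K Bi Fje
    have h2 : Module.finrank K Fje = p ^ (n + j) := by
      have : Module.finrank K (Fje.restrictScalars K) = Module.finrank K Fji := by
        rw [hFje, IntermediateField.extendScalars_restrictScalars]
      rw [← κ.finrank_layer_holds (n + j), eFj.toLinearEquiv.finrank_eq, ← this]; rfl
    rw [hdegKB, h2, pow_add] at h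
    exact Nat.eq_of_mul_eq_mul_left (pow_pos hp0 n) h
  have hGpcard : Nat.card (HqF ≃ₐ[Bi] HqF) = p ^ t * p ^ v := by rw [IsGalois.card_aut_eq_finrank, hdegHp]
  -- the Galois group `G_j = Gal(H_p/F_j)` as the image of restriction of scalars
  let ρj : (HqF ≃ₐ[Fje] HqF) →* (HqF ≃ₐ[Bi] HqF) :=
    { toFun := fun σ => σ.restrictScalars Bi
      map_one' := rfl
      map_mul' := fun _ _ => rfl }
  have hρj_inj : Function.Injective ρj := fun σ τ h => AlgEquiv.restrictScalars_injective Bi h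
  have hρj_apply : ∀ a y, ρj a y = a y := fun _ _ => rfl
  obtain ⟨Gj, hGj⟩ : ∃ Gj : Subgroup (HqF ≃ₐ[Bi] HqF), Gj = ρj.range := ⟨_, rfl⟩
  have hGjcard' : Nat.card (HqF ≃ₐ[Fje] HqF) * p ^ j = p ^ t * p ^ v := by
    have h1 := Module.finrank_mul_finrank Bi Fje HqF
    rw [hdegBFj, hdegHp] at h1
    rw [IsGalois.card_aut_eq_finrank, mul_comm]
    exact h1
  have hGjindex : Gj.index = p ^ j := by
    rw [hGj]
    have h1 := ρj.range.index_mul_card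
    rw [← Nat.card_congr (MonoidHom.ofInjective hρj_inj).toEquiv, hGpcard, ← hGjcard', mul_comm] at h1
    exact Nat.eq_of_mul_eq_mul_left Nat.card_pos h1
  have hA'Gj : A' ≤ Gj := by
    intro x hx
    rw [hGj]
    exact ⟨{ x with commutes' := fun y => (hmemA' x).mp hx (y : κ.layer (n + t)) }, AlgEquiv.ext fun _ => rfl⟩
  -- ### the class-group hypothesis, transported from `K_{n+j}` to `F_j`
  let eL : (κ.layer (n + j)) ≃+* Fje := eFj.toRingEquiv.trans eFje
  have heL : ∀ x : K, eL (algebraMap K (κ.layer (n + j)) x) = algebraMap Bi Fje (algebraMap K Bi x) := by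
    intro x
    apply Subtype.ext
    change ((eFj (algebraMap K (κ.layer (n + j)) x) : Fji) : κ.layer (n + t)) = _
    rw [eFj.commutes]
    rfl
  have hσ' : ∀ (σ' : Fje ≃ₐ[Bi] Fje) (c' : ClassGroup (𝓞 Fje)),
      ClassGroup.mulEquiv (AmbiguousClass.intAut σ') c' * c'⁻¹ ∈
        (powMonoidHom p : ClassGroup (𝓞 Fje) →* ClassGroup (𝓞 Fje)).range := by
    intro σ' c'
    -- `σ'` transported to a `K`-automorphism `σ` of `K_{n+j}`
    have hfix : ∀ x : K, σ' (eL (algebraMap K (κ.layer (n + j)) x)) = eL (algebraMap K (κ.layer (n + j)) x) := by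
      intro x
      rw [heL, AlgEquiv.commutes]
    let σ : (κ.layer (n + j)) ≃ₐ[K] (κ.layer (n + j)) :=
      AlgEquiv.ofRingEquiv (f := eL.trans (σ'.toRingEquiv.trans eL.symm)) fun x => by
        change eL.symm (σ' (eL (algebraMap K (κ.layer (n + j)) x))) = algebraMap K (κ.layer (n + j)) x
        rw [hfix, RingEquiv.symm_apply_apply]
    have hσapply : ∀ y, σ y = eL.symm (σ' (eL y)) := fun _ => rfl
    -- `intAut σ' = E⁻¹ ∘ intAut σ ∘ E` on integers, `E = mapRingEquiv eL`
    set E𝓞 : 𝓞 (κ.layer (n + j)) ≃+* 𝓞 Fje := RingOfIntegers.mapRingEquiv eL with hE𝓞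
    have hint : AmbiguousClass.intAut σ' = E𝓞.symm.trans ((AmbiguousClass.intAut σ).trans E𝓞) := by
      apply RingEquiv.ext
      intro y
      apply Subtype.ext
      change σ' (y : Fje) = eL (σ (eL.symm (y : Fje)))
      rw [hσapply, RingEquiv.apply_symm_apply, RingEquiv.apply_symm_apply]
    have hEE : (ClassGroup.mulEquiv E𝓞.symm).trans (ClassGroup.mulEquiv E𝓞) = MulEquiv.refl _ := by
      rw [← Honda1971.classGroup_mulEquiv_trans, RingEquiv.symm_trans_self, Honda1971.classGroup_mulEquiv_refl]
    set c : ClassGroup (𝓞 (κ.layer (n + j))) := ClassGroup.mulEquiv E𝓞.symm c' with hc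
    have hcc' : ClassGroup.mulEquiv E𝓞 c = c' := by
      rw [hc, ← MulEquiv.trans_apply, hEE, MulEquiv.refl_apply]
    obtain ⟨d, hd⟩ := hσ σ c
    rw [powMonoidHom_apply] at hd
    refine ⟨ClassGroup.mulEquiv E𝓞 d, ?_⟩
    rw [powMonoidHom_apply, ← map_pow, hd, map_mul, map_inv, hcc', hint, Honda1971.classGroup_mulEquiv_trans, Honda1971.classGroup_mulEquiv_trans,
      MulEquiv.trans_apply, MulEquiv.trans_apply, ← hc]
  -- ### class field theory: centrality modulo `N_j P_j` inside `Gal(H_p/F_j)`, then transport along `ρj`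
  have hcentral := commutator_top_range_le_map_of_classGroup_mulEquiv Bi Fje HqF p hσ' ρj hρj_apply
  obtain ⟨Nj, hNj⟩ : ∃ Nj : Subgroup (HqF ≃ₐ[Fje] HqF), Nj =
      ⁅(⊤ : Subgroup (HqF ≃ₐ[Fje] HqF)), ⊤⁆ ⊔ ⨆ (Q : MaximalSpectrum (𝓞 HqF)), Q.asIdeal.inertia (HqF ≃ₐ[Fje] HqF) :=
    ⟨_, rfl⟩
  have hmapI : ∀ Q : MaximalSpectrum (𝓞 HqF),
      (Q.asIdeal.inertia (HqF ≃ₐ[Fje] HqF)).map ρj = Q.asIdeal.inertia (HqF ≃ₐ[Bi] HqF) ⊓ ρj.range := by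
    intro Q
    ext x
    constructor
    · rintro ⟨σ, hσI, rfl⟩
      exact ⟨fun y => hσI y, ⟨σ, rfl⟩⟩
    · rintro ⟨hgI, ⟨σ, rfl⟩⟩
      exact ⟨σ, fun y => hgI y, rfl⟩
  have hmapN : Nj.map ρj = ⁅Gj, Gj⁆ ⊔ ⨆ I ∈ 𝓘, I ⊓ Gj := by
    rw [hGj, hNj, Subgroup.map_sup, Subgroup.map_commutator, ← MonoidHom.range_eq_map, Subgroup.map_iSup, h𝓘def,
      iSup_range]
    simp_rw [hmapI]
  have hmapP : (Subgroup.closure (Set.range fun σ : HqF ≃ₐ[Fje] HqF => σ ^ p)).map ρj =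
      Subgroup.closure ((fun x : HqF ≃ₐ[Bi] HqF => x ^ p) '' (Gj : Set (HqF ≃ₐ[Bi] HqF))) := by
    rw [MonoidHom.map_closure]
    congr 1
    ext x
    constructor
    · rintro ⟨_, ⟨σ, rfl⟩, rfl⟩
      exact ⟨ρj σ, by rw [hGj]; exact ⟨σ, rfl⟩, by rw [map_pow]⟩
    · rintro ⟨y, hy, rfl⟩
      rw [hGj] at hy
      obtain ⟨σ, rfl⟩ := hy
      exact ⟨σ ^ p, ⟨σ, rfl⟩, by rw [map_pow]⟩
  refine ⟨Gj, hA'Gj, hGjindex, ?_⟩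
  rw [← hmapN, ← hmapP, ← Subgroup.map_sup, hNj, hGj]
  exact hcentral

end Literature.NumberTheory.IwasawaTheory

end
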